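import Mathlib
import Summits.Ventures.PercRepro2.Defs
import Summits.Ventures.PercRepro2.Harris
import Summits.Ventures.PercRepro2.CoinDefs
import Summits.Ventures.PercRepro2.CoinReverse
import Summits.Ventures.PercRepro2.CoinLsmCoreDefs
import Summits.Ventures.PercRepro2.CoinLsmCoreU

/-!
# The undirected square core (blind cell PercRepro2, night-2 g8; proofs/NIGHT2-DARC.md §31.5)

`SquareCore arcs s p q a c₁ c₂ c₃ c₄`: the four antiparallel-pair coins `c₁ = s ↔ p`, `c₂ = s ↔ q`,
`c₃ = p ↔ a`, `c₄ = q ↔ a` are the ONLY coins with an arc into `{s, p, q, a}`; nothing else is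
assumed (the head — entries from `s, p, q, a` anywhere, the target, the arc `u → w` — is
arbitrary).  The core is closed in (`ClosedInCoreU`), reachability of `p`, `q`, `a` from `s` is
a Boolean function of the four coins (`reach_p_iff`, `reach_q_iff`, `reach_a_iff`: `p` is reached
through `α` or through the route `β δ γ`, `a` through `α γ` or `β δ`), and the core levels are
unions of the cylinders of the four coins (`mem_coreLevel_iff`).
-/

namespace Summit.Ventures.PercRepro2.Coin

open Classical

section SquareCoreDefs

variable {V : Type*} {E : Type*} [DecidableEq V]

/-- The undirected square core `s — p — a — q — s`: the four pair-coins and «no other coin enters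
`{s, p, q, a}`». -/
structure SquareCore (arcs : E → Finset (V × V)) (s p q a : V) (c₁ c₂ c₃ c₄ : E) : Prop where
  arc₁ : arcs c₁ = {(s, p), (p, s)}
  arc₂ : arcs c₂ = {(s, q), (q, s)}
  arc₃ : arcs c₃ = {(p, a), (a, p)}
  arc₄ : arcs c₄ = {(q, a), (a, q)}
  core : ∀ e, ∀ xy ∈ arcs e, (xy.2 = s ∨ xy.2 = p ∨ xy.2 = q ∨ xy.2 = a) →
    e = c₁ ∨ e = c₂ ∨ e = c₃ ∨ e = c₄
  sp : s ≠ p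
  sq : s ≠ q
  sa : s ≠ a
  pq : p ≠ q
  pa : p ≠ a
  qa : q ≠ a

variable {arcs : E → Finset (V × V)} {s p q a : V} {c₁ c₂ c₃ c₄ : E}

omit [DecidableEq V] in
/-- A set containing `x` and closed under the open arcs contains everything reachable from `x`. -/
lemma reach_mem_of_closed {ω : Config E} {U : Set V}
    (hU : ∀ e, ω e = true → ∀ xy ∈ arcs e, xy.1 ∈ U → xy.2 ∈ U) {x y : V} (hx : x ∈ U)
    (hr : Reach arcs ω x y) : y ∈ U := by
  induction hr with
  | refl => exact hx
  | tail _ hstep ih =>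
    obtain ⟨e, he, hxy⟩ := hstep
    exact hU e he _ hxy ih

/-- The square core is closed in (relaxed sense: arcs into `s` from the core are allowed). -/
theorem SquareCore.closedInCoreU (h : SquareCore arcs s p q a c₁ c₂ c₃ c₄) :
    ClosedInCoreU arcs s {p, q, a} := by
  refine ⟨?_, ?_, ?_⟩
  · intro e xy hxy hy
    simp only [Finset.mem_insert, Finset.mem_singleton] at hy
    have hc := h.core e xy hxy (by tauto)
    simp only [Finset.mem_insert, Finset.mem_singleton]
    rcases hc with rfl | rfl | rfl | rfl
    · rw [h.arc₁] at hxy; simp only [Finset.mem_insert, Finset.mem_singleton] at hxy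
      rcases hxy with rfl | rfl <;> simp
    · rw [h.arc₂] at hxy; simp only [Finset.mem_insert, Finset.mem_singleton] at hxy
      rcases hxy with rfl | rfl <;> simp
    · rw [h.arc₃] at hxy; simp only [Finset.mem_insert, Finset.mem_singleton] at hxy
      rcases hxy with rfl | rfl <;> simp
    · rw [h.arc₄] at hxy; simp only [Finset.mem_insert, Finset.mem_singleton] at hxy
      rcases hxy with rfl | rfl <;> simp
  · intro e xy hxy hy
    have hc := h.core e xy hxy (Or.inl hy)
    simp only [Finset.mem_insert, Finset.mem_singleton]
    rcases hc with rfl | rfl | rfl | rfl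
    · rw [h.arc₁] at hxy; simp only [Finset.mem_insert, Finset.mem_singleton] at hxy
      rcases hxy with rfl | rfl <;> simp
    · rw [h.arc₂] at hxy; simp only [Finset.mem_insert, Finset.mem_singleton] at hxy
      rcases hxy with rfl | rfl <;> simp
    · rw [h.arc₃] at hxy; simp only [Finset.mem_insert, Finset.mem_singleton] at hxy
      rcases hxy with rfl | rfl <;> simp
    · rw [h.arc₄] at hxy; simp only [Finset.mem_insert, Finset.mem_singleton] at hxy
      rcases hxy with rfl | rfl <;> simp
  · simp only [Finset.mem_insert, Finset.mem_singleton, not_or]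
    exact ⟨h.sp, h.sq, h.sa⟩

/-- **The closure lemma of the square**: if `Z ⊆ {p, q, a}` and no OPEN pair-coin carries an arc
from outside `Z` into `Z`, then nothing reachable from `s` lies in `Z`. -/
lemma SquareCore.not_reach_of_closed (h : SquareCore arcs s p q a c₁ c₂ c₃ c₄) {ω : Config E}
    {Z : Set V} (hZs : s ∉ Z) (hZ : ∀ v ∈ Z, v = p ∨ v = q ∨ v = a)
    (h₁ : ω c₁ = true → ∀ xy ∈ arcs c₁, xy.2 ∈ Z → xy.1 ∈ Z)
    (h₂ : ω c₂ = true → ∀ xy ∈ arcs c₂, xy.2 ∈ Z → xy.1 ∈ Z)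
    (h₃ : ω c₃ = true → ∀ xy ∈ arcs c₃, xy.2 ∈ Z → xy.1 ∈ Z)
    (h₄ : ω c₄ = true → ∀ xy ∈ arcs c₄, xy.2 ∈ Z → xy.1 ∈ Z)
    {y : V} (hy : y ∈ Z) : ¬ Reach arcs ω s y := by
  intro hr
  have key := reach_mem_of_closed (U := Zᶜ) ?_ hZs hr
  · exact key hy
  · intro e he xy hxy hx hy'
    have hc := h.core e xy hxy (by rcases hZ _ hy' with h' | h' | h' <;> simp [h'])
    rcases hc with rfl | rfl | rfl | rfl
    · exact hx (h₁ he xy hxy hy')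
    · exact hx (h₂ he xy hxy hy')
    · exact hx (h₃ he xy hxy hy')
    · exact hx (h₄ he xy hxy hy')

/-- The closure condition of a pair-coin `{(x, y), (y, x)}` into `Z`. -/
lemma pair_closed_iff {Z : Set V} {x y : V} :
    (∀ xy ∈ ({(x, y), (y, x)} : Finset (V × V)), xy.2 ∈ Z → xy.1 ∈ Z) ↔
      (y ∈ Z → x ∈ Z) ∧ (x ∈ Z → y ∈ Z) := by
  simp only [Finset.mem_insert, Finset.mem_singleton, forall_eq_or_imp, forall_eq]

/-- `s ⇝ p` iff `α` is open or the route `β, δ, γ` is open. -/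
theorem SquareCore.reach_p_iff (h : SquareCore arcs s p q a c₁ c₂ c₃ c₄) (ω : Config E) :
    Reach arcs ω s p ↔ ω c₁ = true ∨ (ω c₂ = true ∧ ω c₄ = true ∧ ω c₃ = true) := by
  have hps : p ≠ s := h.sp.symm
  have hqs : q ≠ s := h.sq.symm
  have has : a ≠ s := h.sa.symm
  have hqp : q ≠ p := h.pq.symm
  have hap : a ≠ p := h.pa.symm
  have haq : a ≠ q := h.qa.symm
  constructor
  · intro hr
    by_cases hb1 : ω c₁ = true
    · exact Or.inl hb1
    simp only [Bool.not_eq_true] at hb1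
    by_cases hb2 : ω c₂ = true
    · by_cases hb4 : ω c₄ = true
      · by_cases hb3 : ω c₃ = true
        · exact Or.inr ⟨hb2, hb4, hb3⟩
        simp only [Bool.not_eq_true] at hb3
        exfalso
        refine h.not_reach_of_closed (Z := {v | v = p}) (by simp [h.sp]) (by simp) ?_ ?_ ?_ ?_
          (by simp) hr
        · intro h'; simp [hb1] at h'
        · intro _; rw [h.arc₂, pair_closed_iff]; simp [hqp, h.sp]
        · intro h'; simp [hb3] at h'
        · intro _; rw [h.arc₄, pair_closed_iff]; simp [hqp, hap]
      · simp only [Bool.not_eq_true] at hb4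
        exfalso
        refine h.not_reach_of_closed (Z := {v | v = p ∨ v = a}) (by simp [h.sp, h.sa]) (by simp)
          ?_ ?_ ?_ ?_ (by simp) hr
        · intro h'; simp [hb1] at h'
        · intro _; rw [h.arc₂, pair_closed_iff]; simp [hqp, h.qa, h.sp, h.sa]
        · intro _; rw [h.arc₃, pair_closed_iff]; simp
        · intro h'; simp [hb4] at h'
    · simp only [Bool.not_eq_true] at hb2
      exfalso
      refine h.not_reach_of_closed (Z := {v | v = p ∨ v = q ∨ v = a}) (by simp [h.sp, h.sq, h.sa])
        (by simp) ?_ ?_ ?_ ?_ (by simp) hr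
      · intro h'; simp [hb1] at h'
      · intro h'; simp [hb2] at h'
      · intro _; rw [h.arc₃, pair_closed_iff]; simp
      · intro _; rw [h.arc₄, pair_closed_iff]; simp
  · rintro (h1 | ⟨h2, h4, h3⟩)
    · exact reach_of_openArc ⟨c₁, h1, by rw [h.arc₁]; simp⟩
    · have r1 : Reach arcs ω s q := reach_of_openArc ⟨c₂, h2, by rw [h.arc₂]; simp⟩
      have r2 : Reach arcs ω q a := reach_of_openArc ⟨c₄, h4, by rw [h.arc₄]; simp⟩
      have r3 : Reach arcs ω a p := reach_of_openArc ⟨c₃, h3, by rw [h.arc₃]; simp⟩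
      exact reach_trans r1 (reach_trans r2 r3)

/-- `s ⇝ q` iff `β` is open or the route `α, γ, δ` is open. -/
theorem SquareCore.reach_q_iff (h : SquareCore arcs s p q a c₁ c₂ c₃ c₄) (ω : Config E) :
    Reach arcs ω s q ↔ ω c₂ = true ∨ (ω c₁ = true ∧ ω c₃ = true ∧ ω c₄ = true) := by
  have haq : a ≠ q := h.qa.symm
  constructor
  · intro hr
    by_cases hb2 : ω c₂ = true
    · exact Or.inl hb2
    simp only [Bool.not_eq_true] at hb2
    by_cases hb1 : ω c₁ = true
    · by_cases hb3 : ω c₃ = true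
      · by_cases hb4 : ω c₄ = true
        · exact Or.inr ⟨hb1, hb3, hb4⟩
        simp only [Bool.not_eq_true] at hb4
        exfalso
        refine h.not_reach_of_closed (Z := {v | v = q}) (by simp [h.sq]) (by simp) ?_ ?_ ?_ ?_
          (by simp) hr
        · intro _; rw [h.arc₁, pair_closed_iff]; simp [h.pq, h.sq]
        · intro h'; simp [hb2] at h'
        · intro _; rw [h.arc₃, pair_closed_iff]; simp [h.pq, haq]
        · intro h'; simp [hb4] at h'
      · simp only [Bool.not_eq_true] at hb3
        exfalso
        refine h.not_reach_of_closed (Z := {v | v = q ∨ v = a}) (by simp [h.sq, h.sa]) (by simp)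
          ?_ ?_ ?_ ?_ (by simp) hr
        · intro _; rw [h.arc₁, pair_closed_iff]; simp [h.pq, h.pa, h.sq, h.sa]
        · intro h'; simp [hb2] at h'
        · intro h'; simp [hb3] at h'
        · intro _; rw [h.arc₄, pair_closed_iff]; simp
    · simp only [Bool.not_eq_true] at hb1
      exfalso
      refine h.not_reach_of_closed (Z := {v | v = p ∨ v = q ∨ v = a}) (by simp [h.sp, h.sq, h.sa])
        (by simp) ?_ ?_ ?_ ?_ (by simp) hr
      · intro h'; simp [hb1] at h'
      · intro h'; simp [hb2] at h'
      · intro _; rw [h.arc₃, pair_closed_iff]; simp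
      · intro _; rw [h.arc₄, pair_closed_iff]; simp
  · rintro (h2 | ⟨h1, h3, h4⟩)
    · exact reach_of_openArc ⟨c₂, h2, by rw [h.arc₂]; simp⟩
    · have r1 : Reach arcs ω s p := reach_of_openArc ⟨c₁, h1, by rw [h.arc₁]; simp⟩
      have r2 : Reach arcs ω p a := reach_of_openArc ⟨c₃, h3, by rw [h.arc₃]; simp⟩
      have r3 : Reach arcs ω a q := reach_of_openArc ⟨c₄, h4, by rw [h.arc₄]; simp⟩
      exact reach_trans r1 (reach_trans r2 r3)

/-- `s ⇝ a` iff the route `α, γ` or the route `β, δ` is open. -/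
theorem SquareCore.reach_a_iff (h : SquareCore arcs s p q a c₁ c₂ c₃ c₄) (ω : Config E) :
    Reach arcs ω s a ↔ (ω c₁ = true ∧ ω c₃ = true) ∨ (ω c₂ = true ∧ ω c₄ = true) := by
  have hqp : q ≠ p := h.pq.symm
  have hap : a ≠ p := h.pa.symm
  have haq : a ≠ q := h.qa.symm
  constructor
  · intro hr
    by_cases h13 : ω c₁ = true ∧ ω c₃ = true
    · exact Or.inl h13
    by_cases h24 : ω c₂ = true ∧ ω c₄ = true
    · exact Or.inr h24
    exfalso
    by_cases hb1 : ω c₁ = true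
    · have hb3 : ω c₃ = false := by
        cases hc : ω c₃
        · rfl
        · exact absurd ⟨hb1, hc⟩ h13
      by_cases hb2 : ω c₂ = true
      · have hb4 : ω c₄ = false := by
          cases hc : ω c₄
          · rfl
          · exact absurd ⟨hb2, hc⟩ h24
        refine h.not_reach_of_closed (Z := {v | v = a}) (by simp [h.sa]) (by simp) ?_ ?_ ?_ ?_
          (by simp) hr
        · intro _; rw [h.arc₁, pair_closed_iff]; simp [h.pa, h.sa]
        · intro _; rw [h.arc₂, pair_closed_iff]; simp [h.qa, h.sa]
        · intro h'; simp [hb3] at h'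
        · intro h'; simp [hb4] at h'
      · simp only [Bool.not_eq_true] at hb2
        refine h.not_reach_of_closed (Z := {v | v = q ∨ v = a}) (by simp [h.sq, h.sa]) (by simp)
          ?_ ?_ ?_ ?_ (by simp) hr
        · intro _; rw [h.arc₁, pair_closed_iff]; simp [h.pq, h.pa, h.sq, h.sa]
        · intro h'; simp [hb2] at h'
        · intro h'; simp [hb3] at h'
        · intro _; rw [h.arc₄, pair_closed_iff]; simp
    · simp only [Bool.not_eq_true] at hb1
      by_cases hb2 : ω c₂ = true
      · have hb4 : ω c₄ = false := by
          cases hc : ω c₄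
          · rfl
          · exact absurd ⟨hb2, hc⟩ h24
        refine h.not_reach_of_closed (Z := {v | v = p ∨ v = a}) (by simp [h.sp, h.sa]) (by simp)
          ?_ ?_ ?_ ?_ (by simp) hr
        · intro h'; simp [hb1] at h'
        · intro _; rw [h.arc₂, pair_closed_iff]; simp [hqp, h.qa, h.sp, h.sa]
        · intro _; rw [h.arc₃, pair_closed_iff]; simp
        · intro h'; simp [hb4] at h'
      · simp only [Bool.not_eq_true] at hb2
        refine h.not_reach_of_closed (Z := {v | v = p ∨ v = q ∨ v = a})
          (by simp [h.sp, h.sq, h.sa]) (by simp) ?_ ?_ ?_ ?_ (by simp) hr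
        · intro h'; simp [hb1] at h'
        · intro h'; simp [hb2] at h'
        · intro _; rw [h.arc₃, pair_closed_iff]; simp
        · intro _; rw [h.arc₄, pair_closed_iff]; simp
  · rintro (⟨h1, h3⟩ | ⟨h2, h4⟩)
    · have r1 : Reach arcs ω s p := reach_of_openArc ⟨c₁, h1, by rw [h.arc₁]; simp⟩
      have r2 : Reach arcs ω p a := reach_of_openArc ⟨c₃, h3, by rw [h.arc₃]; simp⟩
      exact reach_trans r1 r2
    · have r1 : Reach arcs ω s q := reach_of_openArc ⟨c₂, h2, by rw [h.arc₂]; simp⟩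
      have r2 : Reach arcs ω q a := reach_of_openArc ⟨c₄, h4, by rw [h.arc₄]; simp⟩
      exact reach_trans r1 r2

end SquareCoreDefs

section SquareLevels

variable {V : Type*} {E : Type*} [DecidableEq V] [Fintype E] [DecidableEq E]
  {R : Type*} [Field R]
  {arcs : E → Finset (V × V)} {s p q a : V} {c₁ c₂ c₃ c₄ : E}

omit [DecidableEq V] in
/-- **The four-coin partition**: any probability is the sum over the `16` cylinders of four
distinct coins. -/
lemma prob_eq_sum_cyl4 (p : E → R) (A : Set (Config E)) :
    prob p A = ∑ b : Bool × Bool × Bool × Bool,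
      prob p (A ∩ {ω | ω c₁ = b.1 ∧ ω c₂ = b.2.1 ∧ ω c₃ = b.2.2.1 ∧ ω c₄ = b.2.2.2}) := by
  unfold prob
  rw [Finset.sum_comm]
  refine Finset.sum_congr rfl fun ω _ => ?_
  rw [Finset.sum_eq_single (ω c₁, ω c₂, ω c₃, ω c₄)]
  · by_cases hA : ω ∈ A
    · have hmem : ω ∈ A ∩ {ω' : Config E | ω' c₁ = (ω c₁, ω c₂, ω c₃, ω c₄).1 ∧
          ω' c₂ = (ω c₁, ω c₂, ω c₃, ω c₄).2.1 ∧ ω' c₃ = (ω c₁, ω c₂, ω c₃, ω c₄).2.2.1 ∧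
          ω' c₄ = (ω c₁, ω c₂, ω c₃, ω c₄).2.2.2} := ⟨hA, rfl, rfl, rfl, rfl⟩
      rw [Set.indicator_of_mem hA, Set.indicator_of_mem hmem]
    · rw [Set.indicator_of_notMem hA, Set.indicator_of_notMem (fun h' => hA h'.1)]
  · intro b _ hb
    rw [Set.indicator_of_notMem]
    rintro ⟨_, h1, h2, h3, h4⟩
    apply hb
    obtain ⟨b₁, b₂, b₃, b₄⟩ := b
    simp only at h1 h2 h3 h4
    rw [h1, h2, h3, h4]
  · intro h; exact absurd (Finset.mem_univ _) h

omit [DecidableEq V] in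
/-- The probability of a four-coin cylinder (distinct coins). -/
lemma prob_cyl4 (p : E → R) (h12 : c₁ ≠ c₂) (h13 : c₁ ≠ c₃) (h14 : c₁ ≠ c₄) (h23 : c₂ ≠ c₃)
    (h24 : c₂ ≠ c₄) (h34 : c₃ ≠ c₄) (b : Bool × Bool × Bool × Bool) :
    prob p {ω | ω c₁ = b.1 ∧ ω c₂ = b.2.1 ∧ ω c₃ = b.2.2.1 ∧ ω c₄ = b.2.2.2} =
      edgeFactor (p c₁) b.1 * edgeFactor (p c₂) b.2.1 * edgeFactor (p c₃) b.2.2.1 *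
        edgeFactor (p c₄) b.2.2.2 := by
  obtain ⟨b₁, b₂, b₃, b₄⟩ := b
  set σ : Config E := fun e => if e = c₁ then b₁ else if e = c₂ then b₂ else if e = c₃ then b₃
    else if e = c₄ then b₄ else false with hσ
  have hset : {ω : Config E | ω c₁ = b₁ ∧ ω c₂ = b₂ ∧ ω c₃ = b₃ ∧ ω c₄ = b₄} =
      cylinder {c₁, c₂, c₃, c₄} σ := by
    ext ω
    simp only [Set.mem_setOf_eq, mem_cylinder, Finset.mem_insert, Finset.mem_singleton,
      forall_eq_or_imp, forall_eq, hσ, if_true, if_neg h12.symm, if_neg h13.symm, if_neg h14.symm,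
      if_neg h23.symm, if_neg h24.symm, if_neg h34.symm]
  rw [hset, prob_cylinder]
  have h1 : c₁ ∉ ({c₂, c₃, c₄} : Finset E) := by simp [h12, h13, h14]
  have h2 : c₂ ∉ ({c₃, c₄} : Finset E) := by simp [h23, h24]
  have h3 : c₃ ∉ ({c₄} : Finset E) := by simp [h34]
  rw [Finset.prod_insert h1, Finset.prod_insert h2, Finset.prod_insert h3, Finset.prod_singleton]
  simp only [hσ, if_true, if_neg h12.symm, if_neg h13.symm, if_neg h14.symm, if_neg h23.symm,
    if_neg h24.symm, if_neg h34.symm]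
  ring

omit [Fintype E] [DecidableEq E] in
/-- On the cylinder of `b`, membership in the core level of `W` is the Boolean condition
`(p ∈ W ↔ b₁ ∨ b₂ b₄ b₃) ∧ (q ∈ W ↔ b₂ ∨ b₁ b₃ b₄) ∧ (a ∈ W ↔ b₁ b₃ ∨ b₂ b₄)`. -/
lemma SquareCore.level_inter_cyl (h : SquareCore arcs s p q a c₁ c₂ c₃ c₄) (W : Finset V)
    (b : Bool × Bool × Bool × Bool) :
    coreLevel arcs s {p, q, a} W ∩ {ω | ω c₁ = b.1 ∧ ω c₂ = b.2.1 ∧ ω c₃ = b.2.2.1 ∧ ω c₄ = b.2.2.2}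
      = if (p ∈ W ↔ (b.1 = true ∨ (b.2.1 = true ∧ b.2.2.2 = true ∧ b.2.2.1 = true))) ∧
          (q ∈ W ↔ (b.2.1 = true ∨ (b.1 = true ∧ b.2.2.1 = true ∧ b.2.2.2 = true))) ∧
          (a ∈ W ↔ ((b.1 = true ∧ b.2.2.1 = true) ∨ (b.2.1 = true ∧ b.2.2.2 = true)))
        then {ω | ω c₁ = b.1 ∧ ω c₂ = b.2.1 ∧ ω c₃ = b.2.2.1 ∧ ω c₄ = b.2.2.2} else ∅ := by
  obtain ⟨b₁, b₂, b₃, b₄⟩ := b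
  ext ω
  have hmem : ω ∈ coreLevel arcs s {p, q, a} W ↔
      (p ∈ W ↔ (ω c₁ = true ∨ (ω c₂ = true ∧ ω c₄ = true ∧ ω c₃ = true))) ∧
        (q ∈ W ↔ (ω c₂ = true ∨ (ω c₁ = true ∧ ω c₃ = true ∧ ω c₄ = true))) ∧
        (a ∈ W ↔ ((ω c₁ = true ∧ ω c₃ = true) ∨ (ω c₂ = true ∧ ω c₄ = true))) := by
    rw [mem_coreLevel]
    simp only [Finset.mem_insert, Finset.mem_singleton, forall_eq_or_imp, forall_eq,
      h.reach_p_iff, h.reach_q_iff, h.reach_a_iff]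
  simp only [Set.mem_inter_iff, hmem, Set.mem_setOf_eq]
  split_ifs with hc
  · simp only [Set.mem_setOf_eq]
    constructor
    · rintro ⟨_, hω⟩; exact hω
    · rintro ⟨h1, h2, h3, h4⟩
      refine ⟨?_, h1, h2, h3, h4⟩
      rw [h1, h2, h3, h4]; exact hc
  · simp only [Set.mem_empty_iff_false, iff_false]
    rintro ⟨hW, h1, h2, h3, h4⟩
    rw [h1, h2, h3, h4] at hW
    exact hc hW

/-- **The core level probabilities of the square** as a sum over the `16` coin configurations. -/
theorem SquareCore.prob_level (h : SquareCore arcs s p q a c₁ c₂ c₃ c₄) (p' : E → R)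
    (h12 : c₁ ≠ c₂) (h13 : c₁ ≠ c₃) (h14 : c₁ ≠ c₄) (h23 : c₂ ≠ c₃) (h24 : c₂ ≠ c₄) (h34 : c₃ ≠ c₄)
    (W : Finset V) :
    prob p' (coreLevel arcs s {p, q, a} W) = ∑ b : Bool × Bool × Bool × Bool,
      if (p ∈ W ↔ (b.1 = true ∨ (b.2.1 = true ∧ b.2.2.2 = true ∧ b.2.2.1 = true))) ∧
          (q ∈ W ↔ (b.2.1 = true ∨ (b.1 = true ∧ b.2.2.1 = true ∧ b.2.2.2 = true))) ∧
          (a ∈ W ↔ ((b.1 = true ∧ b.2.2.1 = true) ∨ (b.2.1 = true ∧ b.2.2.2 = true)))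
        then edgeFactor (p' c₁) b.1 * edgeFactor (p' c₂) b.2.1 * edgeFactor (p' c₃) b.2.2.1 *
          edgeFactor (p' c₄) b.2.2.2 else 0 := by
  rw [prob_eq_sum_cyl4 (c₁ := c₁) (c₂ := c₂) (c₃ := c₃) (c₄ := c₄)]
  refine Finset.sum_congr rfl fun b _ => ?_
  rw [h.level_inter_cyl W b]
  split_ifs
  · exact prob_cyl4 p' h12 h13 h14 h23 h24 h34 b
  · simp [prob]

end SquareLevels

end Summit.Ventures.PercRepro2.Coin
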